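import Mathlib
import Summits.NavierStokesRegularity.NavierStokesRegularity.Theorems.SubOnsagerCeilingSideBranchParkingReduction
import Summits.NavierStokesRegularity.NavierStokesRegularity.Theorems.SubOnsagerCeilingSideBranchCaptureLaw
import HarnessLib

/-!
# Route SubOnsagerCeiling — the escape debt of `α_SB` is a FOURTH-MOMENT OCCUPATION BOUND for its chain
# (reduction, def-free; helper file for item stmt-NavierStokesRegularity-25507 `OrthantTailCeiling`; `--supports`)

The conditional refutations of the aside cruxes `OrthantTailCeiling` (stmt-25507) / `ForwardTailCeiling`
(stmt-26608) on the side-branch dead-end table `α_SB = sideBranchTable` are reduced to a UNIFORM PARKING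
BOUND (`sideBranchCeilingEscapeAt_of_parkingBound`, this lineage): the first pockets never hold more than
`(1 − q)E₀`.  The CAPTURE LAW (`sideBranch_capture_law`, this lineage; true dynamics, no sign condition):
`(s_k² + z_{k+1}²)^{3/2} ≤ 4e^{ν_{k+1}t}(Λ_k/5)∫₀ᵗx_k⁴` bounds every pocket by the fourth-moment occupation of
the chain mode feeding it.  Hence the whole remaining debt is a statement about the CHAIN MODES ONLY:

**OCCUPATION BOUND** (hypothesis inline in `sideBranchCeilingEscapeAt_of_occupationBound`): there is `q > 0`
such that for every candidate ceiling `(θ, C)` some chain datum (`x₀ ≥ 0` on component `0`, nothing else,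
`E₀ > 0`) has, for every depth `K`, a threshold `ν₀` with: along every regular `ν`-viscous solution
(`0 < ν ≤ ν₀`) on any `[0,s]`, non-negative on the shells `≥ 1` and obeying the `(θ, C)` ceiling,
`Σ_{j<K} ½·(4e^{ν_{j+1}t}(Λ_j/5)∫₀ᵗ x_j⁴)^{2/3} ≤ (1 − q)E₀` for all `t ∈ [0,s]` — a sub-Kolmogorov bound
on the time-integrated fourth moments of the chain (brief fronts, weak wake; the Kolmogorov wake
`x_j ≍ Λ_j^{-1/3}t^{-1}` of Barbato–Flandoli–Morandin's self-similar solutions has `Λ_j∫x_j⁴ ≍ Λ_j^{-1/3}`).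

* `sideBranch_le_rpow_of_mul_sqrt_le` — `Y ≥ 0`, `Y√Y ≤ M ⇒ Y ≤ M^{2/3}`;
* `sideBranch_pocket_zero_eq_zero` — with no shells below `0` and `z₀(0) = 0`, `z₀ ≡ 0`;
* `sideBranch_pocket_sq_le_occupation` — `z_{k+1}(t)² ≤ (4e^{ν_{k+1}t}(Λ_k/5)∫₀ᵗx_k⁴)^{2/3}` (capture law);
* **`sideBranchCeilingEscapeAt_of_occupationBound`** — OCCUPATION BOUND (`q`) `⇒ SideBranchCeilingEscapeAt ε₀`
  (via the parking bound with the same `q`); `orthantTailCeiling_false_of_occupationBound`,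
  `forwardTailCeiling_false_of_occupationBound` — BY NAME.

NOT proved here: the occupation bound (open in print; the best rigorous Kolmogorov-type bound for the
positive dyadic chain, Barbato–Morandin 2013 `sup_n k_n^{1/3−1/(3β)}X_n ≤ Ct^{-1/3}`, gives
`Λ_j∫x_j⁴ ≲ Λ_j^{+1/5}` at `b = 2`, which does not sum; the numerics' `88–90 %` parking at pump `1/5` leaves a
`10 %` margin, so a proof will want the witness re-parametrised with a small pump coefficient).

HONEST FRAMING: MODEL lattice ODEs only (Tao 2016 §4 vocabulary; rung TL-M2Break); a reduction between
unproved statements plus elementary real analysis; settles nothing by itself; nothing here is a statement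
about the Navier–Stokes equations. [cite: Tao2016AveragedNS, §4 (4.2)–(4.3), (4.5)];
Katz–Pavlović couplings: [cite: BarbatoMorandinRomito2011, §2].
-/

noncomputable section

-- the sub-problem namespace `NavierStokesRegularity.NavierStokesRegularity` is the tree's layout (D-0017)
set_option linter.dupNamespace false

namespace Summit.NavierStokesRegularity.NavierStokesRegularity.Theorems.SubOnsagerCeiling

open Set Filter MeasureTheory intervalIntegral
open scoped Topology
open Literature.Analysis.FluidPDE.TaoCascade
open Summit.NavierStokesRegularity.NavierStokesRegularity.Theses.SubOnsagerCeiling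

/-- `Y ≥ 0` and `Y·√Y ≤ M` give `Y ≤ M^{2/3}`. [folklore] -/
theorem sideBranch_le_rpow_of_mul_sqrt_le {Y M : ℝ} (hY : 0 ≤ Y) (h : Y * Real.sqrt Y ≤ M) :
    Y ≤ M ^ ((2 : ℝ) / 3) := by
  have hM : 0 ≤ M := le_trans (mul_nonneg hY (Real.sqrt_nonneg _)) h
  have h32 : Y ^ ((3 : ℝ) / 2) = Y * Real.sqrt Y := by
    rw [Real.sqrt_eq_rpow, show ((3 : ℝ) / 2) = 1 + 1 / 2 by norm_num,
      Real.rpow_add' hY (by norm_num), Real.rpow_one]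
  have h1 : Y ^ ((3 : ℝ) / 2) ≤ M := by rw [h32]; exact h
  have h2 : (Y ^ ((3 : ℝ) / 2)) ^ ((2 : ℝ) / 3) ≤ M ^ ((2 : ℝ) / 3) :=
    Real.rpow_le_rpow (Real.rpow_nonneg hY _) h1 (by norm_num)
  have h3 : (Y ^ ((3 : ℝ) / 2)) ^ ((2 : ℝ) / 3) = Y := by
    rw [← Real.rpow_mul hY, show ((3 : ℝ) / 2) * (2 / 3) = 1 by norm_num, Real.rpow_one]
  rw [h3] at h2
  exact h2

section Solution

variable {ε₀ ν s : ℝ} {X : Fin 4 → ℤ → ℝ → ℝ}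

/-- **The datum-shell pocket stays empty**: with no shells below `0` and `z₀(0) = 0`, `z₀ ≡ 0` on `[0,s]`
(`ż₀ = (Λ_{-1}/5)s_{-1}² − νz₀ = −νz₀`). [this file] -/
theorem sideBranch_pocket_zero_eq_zero
    (hlow : ∀ (i : Fin 4) (k : ℤ), k < 0 → ∀ t : ℝ, X i k t = 0)
    (hder : ∀ (i : Fin 4) (k : ℤ), ∀ t ∈ Icc (0 : ℝ) s, HasDerivWithinAt (X i k)
      (quadTerm ε₀ sideBranchTable X i k t - ν * (1 + ε₀) ^ ((2 : ℝ) * k) * X i k t)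
      (Icc (0 : ℝ) s) t)
    (h0 : X 2 0 0 = 0) {t : ℝ} (ht : t ∈ Icc (0 : ℝ) s) : X 2 0 t = 0 := by
  have hq : Continuous fun _ : ℝ => ν * (1 + ε₀) ^ ((2 : ℝ) * ((0 : ℤ) : ℝ)) := continuous_const
  have hquad : ∀ u : ℝ, quadTerm ε₀ sideBranchTable X 2 0 u = 0 := by
    intro u
    rw [sideBranch_quadTerm_two, hlow 1 (0 - 1) (by norm_num) u]
    ring
  have h1 : 0 ≤ X 2 0 t := by
    refine sideBranch_linear_sign (p := fun _ => 0) hq (hder 2 0) (fun u _ => ?_) (fun u _ => le_rfl)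
      h0.symm.le ht
    rw [hquad]
  have h2 : 0 ≤ -X 2 0 t := by
    have hder' : ∀ u ∈ Icc (0 : ℝ) s, HasDerivWithinAt (fun u => -X 2 0 u)
        (-(quadTerm ε₀ sideBranchTable X 2 0 u - ν * (1 + ε₀) ^ ((2 : ℝ) * ((0 : ℤ) : ℝ)) * X 2 0 u))
        (Icc (0 : ℝ) s) u := fun u hu => (hder 2 0 u hu).neg
    refine sideBranch_linear_sign (p := fun _ => 0) (y := fun u => -X 2 0 u) hq hder'
      (fun u _ => ?_) (fun u _ => le_rfl) (by simp [h0]) ht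
    rw [hquad]; ring
  linarith

/-- **A pocket is bounded by the fourth-moment occupation of the chain mode below it** (capture law,
this lineage): with `s_k(0) = z_{k+1}(0) = 0`, for `t ∈ [0,s]`,
`z_{k+1}(t)² ≤ (4e^{ν_{k+1}t}(Λ_k/5)∫₀ᵗ x_k⁴)^{2/3}`.  No sign condition, no ceiling. [this file] -/
theorem sideBranch_pocket_sq_le_occupation (hε : 0 < ε₀) (hν : 0 ≤ ν)
    (hcont : ∀ (i : Fin 4) (k : ℤ), Continuous (X i k))
    (hder : ∀ (i : Fin 4) (k : ℤ), ∀ t ∈ Icc (0 : ℝ) s, HasDerivWithinAt (X i k)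
      (quadTerm ε₀ sideBranchTable X i k t - ν * (1 + ε₀) ^ ((2 : ℝ) * k) * X i k t)
      (Icc (0 : ℝ) s) t)
    (k : ℤ) (hs0 : X 1 k 0 = 0) (hz0 : X 2 (k + 1) 0 = 0) {t : ℝ} (ht : t ∈ Icc (0 : ℝ) s) :
    X 2 (k + 1) t ^ 2 ≤
      (4 * Real.exp (ν * (1 + ε₀) ^ ((2 : ℝ) * ((k + 1 : ℤ) : ℝ)) * t) *
        ((1 / 5 : ℝ) * (1 + ε₀) ^ ((5 : ℝ) * k / 2) * ∫ u in (0 : ℝ)..t, X 0 k u ^ 4)) ^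
        ((2 : ℝ) / 3) := by
  have hlaw := sideBranch_capture_law hε hν hcont hder k hs0 hz0 ht
  have hY : 0 ≤ X 1 k t ^ 2 + X 2 (k + 1) t ^ 2 := by positivity
  have h1 := sideBranch_le_rpow_of_mul_sqrt_le hY hlaw
  nlinarith [sq_nonneg (X 1 k t)]

end Solution

/-! ## OCCUPATION BOUND ⇒ PARKING BOUND ⇒ the ceiling-assisted escape -/

/-- **FOURTH-MOMENT OCCUPATION BOUND `→ SideBranchCeilingEscapeAt ε₀`.**  Hypothesis (inline): `q > 0` and
for every candidate ceiling `(θ, C)` a chain datum `X₀` (`X₀ 0 ≥ 0`, `X₀ 1 = X₀ 2 = X₀ 3 = 0`, `E₀ > 0`)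
such that for every depth `K` there is `ν₀ > 0` with: for all `0 < ν ≤ ν₀`, all `s > 0` and every regular
`ν`-viscous solution of `α_SB` on `[0,s]` from `X₀` (one-shell datum, no shells below `0`, weight bound,
continuous modes, exact equation within `[0,s]`), non-negative on the shells `≥ 1` and obeying the `(θ, C)`
tail ceiling on `[0,s]`:
`Σ_{j<K} ½·(4e^{ν_{j+1}t}(Λ_j/5)∫₀ᵗ x_j⁴)^{2/3} ≤ (1 − q)E₀` for all `t ∈ [0,s]`.
Conclusion: `SideBranchCeilingEscapeAt ε₀` (each pocket `z_{j+1}²` is below the `j`-th occupation term by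
`sideBranch_pocket_sq_le_occupation`, the datum pocket is empty, then `sideBranchCeilingEscapeAt_of_parkingBound`).
MODEL lattice only; a reduction between unproved statements. [this file] -/
theorem sideBranchCeilingEscapeAt_of_occupationBound {ε₀ q : ℝ} (hε : 0 < ε₀) (hq : 0 < q)
    (h : ∀ θ : ℝ, 1 / 2 < θ → ∀ C : ℝ, 0 ≤ C →
      ∃ X₀ : Fin 4 → ℝ, 0 ≤ X₀ 0 ∧ X₀ 1 = 0 ∧ X₀ 2 = 0 ∧ X₀ 3 = 0 ∧
      0 < (∑ i : Fin 4, (1 / 2 : ℝ) * X₀ i ^ 2) ∧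
      ∀ K : ℕ, ∃ ν₀ : ℝ, 0 < ν₀ ∧ ∀ ν : ℝ, 0 < ν → ν ≤ ν₀ → ∀ s : ℝ, 0 < s →
      ∀ X : Fin 4 → ℤ → ℝ → ℝ,
      (∀ (i : Fin 4) (k : ℤ), X i k 0 = if k = 0 then X₀ i else 0) →
      (∀ (i : Fin 4) (k : ℤ), k < 0 → ∀ t : ℝ, X i k t = 0) →
      (∃ M : ℝ, ∀ (t : ℝ) (i : Fin 4) (k : ℤ), (1 + (1 + ε₀) ^ ((10 : ℝ) * k)) * |X i k t| ≤ M) →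
      (∀ (i : Fin 4) (k : ℤ), Continuous (X i k)) →
      (∀ (i : Fin 4) (k : ℤ), ∀ t ∈ Set.Icc (0 : ℝ) s, HasDerivWithinAt (X i k)
      (quadTerm ε₀ sideBranchTable X i k t - ν * (1 + ε₀) ^ ((2 : ℝ) * k) * X i k t)
      (Set.Icc (0 : ℝ) s) t) →
      (∀ t ∈ Set.Icc (0 : ℝ) s, ∀ (i : Fin 4) (k : ℤ), 1 ≤ k → 0 ≤ X i k t) →
      (∀ n N : ℕ, n ≤ N → ∀ u ∈ Set.Icc (0 : ℝ) s,
      ∑ k ∈ Finset.Icc n N, ∑ i : Fin 4, (1 / 2 : ℝ) * X i (k : ℤ) u ^ 2 ≤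
      C * (∑ i : Fin 4, (1 / 2 : ℝ) * X₀ i ^ 2) * (1 + ε₀) ^ (-(2 * θ * (n : ℝ)))) →
      ∀ t ∈ Set.Icc (0 : ℝ) s,
      (∑ j ∈ Finset.range K, (1 / 2 : ℝ) *
        (4 * Real.exp (ν * (1 + ε₀) ^ ((2 : ℝ) * (((j : ℤ) + 1 : ℤ) : ℝ)) * t) *
          ((1 / 5 : ℝ) * (1 + ε₀) ^ ((5 : ℝ) * ((j : ℤ) : ℝ) / 2) *
            ∫ u in (0 : ℝ)..t, X 0 (j : ℤ) u ^ 4)) ^ ((2 : ℝ) / 3)) ≤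
      (1 - q) * (∑ i : Fin 4, (1 / 2 : ℝ) * X₀ i ^ 2)) :
    SideBranchCeilingEscapeAt ε₀ := by
  refine sideBranchCeilingEscapeAt_of_parkingBound hε hq fun θ hθ C hC => ?_
  obtain ⟨X₀, hX0, hX1, hX2, hX3, hE₀, hK⟩ := h θ hθ C hC
  refine ⟨X₀, hX0, hX1.symm.le, hX2.symm.le, hX3, hE₀, fun K => ?_⟩
  obtain ⟨ν₀, hν₀, hocc⟩ := hK K
  refine ⟨ν₀, hν₀, fun ν hν hνle s hs X hinit hlow hbd hcont hder hpos hceil t ht => ?_⟩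
  have hocc' := hocc ν hν hνle s hs X hinit hlow hbd hcont hder hpos hceil t ht
  -- pocket `0` is empty, pocket `j+1` is below the `j`-th occupation term
  have hz0 : X 2 0 t = 0 :=
    sideBranch_pocket_zero_eq_zero hlow hder (by rw [hinit 2 0]; simp [hX2]) ht
  have hstep : ∀ j ∈ Finset.range K, (1 / 2 : ℝ) * X 2 (((j + 1 : ℕ) : ℤ)) t ^ 2 ≤
      (1 / 2 : ℝ) * (4 * Real.exp (ν * (1 + ε₀) ^ ((2 : ℝ) * (((j : ℤ) + 1 : ℤ) : ℝ)) * t) *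
        ((1 / 5 : ℝ) * (1 + ε₀) ^ ((5 : ℝ) * ((j : ℤ) : ℝ) / 2) *
          ∫ u in (0 : ℝ)..t, X 0 (j : ℤ) u ^ 4)) ^ ((2 : ℝ) / 3) := by
    intro j _
    have hs0 : X 1 (j : ℤ) 0 = 0 := by
      rw [hinit 1 (j : ℤ)]; by_cases hj : (j : ℤ) = 0 <;> simp [hj, hX1]
    have hz00 : X 2 ((j : ℤ) + 1) 0 = 0 := by
      rw [hinit 2 ((j : ℤ) + 1)]
      have : ((j : ℤ) + 1) ≠ 0 := by omega
      simp [this]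
    have h1 := sideBranch_pocket_sq_le_occupation hε hν.le hcont hder (j : ℤ) hs0 hz00 ht
    push_cast at h1 ⊢
    linarith
  rw [Finset.sum_range_succ', Nat.cast_zero, hz0]
  simp only [ne_eq, OfNat.ofNat_ne_zero, not_false_eq_true, zero_pow, mul_zero, add_zero]
  exact (Finset.sum_le_sum hstep).trans hocc'

/-- **`OrthantTailCeiling` (stmt-25507) BY NAME modulo the fourth-moment occupation bound at some
`ε₀ ∈ (0,1]`** (hypothesis inline, shape of `sideBranchCeilingEscapeAt_of_occupationBound`).  MODEL lattice
only; conditional; settles nothing by itself. [this file] -/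
theorem orthantTailCeiling_false_of_occupationBound
    (h : ∃ ε₀ : ℝ, 0 < ε₀ ∧ ε₀ ≤ 1 ∧ ∃ q : ℝ, 0 < q ∧
      ∀ θ : ℝ, 1 / 2 < θ → ∀ C : ℝ, 0 ≤ C →
      ∃ X₀ : Fin 4 → ℝ, 0 ≤ X₀ 0 ∧ X₀ 1 = 0 ∧ X₀ 2 = 0 ∧ X₀ 3 = 0 ∧
      0 < (∑ i : Fin 4, (1 / 2 : ℝ) * X₀ i ^ 2) ∧
      ∀ K : ℕ, ∃ ν₀ : ℝ, 0 < ν₀ ∧ ∀ ν : ℝ, 0 < ν → ν ≤ ν₀ → ∀ s : ℝ, 0 < s →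
      ∀ X : Fin 4 → ℤ → ℝ → ℝ,
      (∀ (i : Fin 4) (k : ℤ), X i k 0 = if k = 0 then X₀ i else 0) →
      (∀ (i : Fin 4) (k : ℤ), k < 0 → ∀ t : ℝ, X i k t = 0) →
      (∃ M : ℝ, ∀ (t : ℝ) (i : Fin 4) (k : ℤ), (1 + (1 + ε₀) ^ ((10 : ℝ) * k)) * |X i k t| ≤ M) →
      (∀ (i : Fin 4) (k : ℤ), Continuous (X i k)) →
      (∀ (i : Fin 4) (k : ℤ), ∀ t ∈ Set.Icc (0 : ℝ) s, HasDerivWithinAt (X i k)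
      (quadTerm ε₀ sideBranchTable X i k t - ν * (1 + ε₀) ^ ((2 : ℝ) * k) * X i k t)
      (Set.Icc (0 : ℝ) s) t) →
      (∀ t ∈ Set.Icc (0 : ℝ) s, ∀ (i : Fin 4) (k : ℤ), 1 ≤ k → 0 ≤ X i k t) →
      (∀ n N : ℕ, n ≤ N → ∀ u ∈ Set.Icc (0 : ℝ) s,
      ∑ k ∈ Finset.Icc n N, ∑ i : Fin 4, (1 / 2 : ℝ) * X i (k : ℤ) u ^ 2 ≤
      C * (∑ i : Fin 4, (1 / 2 : ℝ) * X₀ i ^ 2) * (1 + ε₀) ^ (-(2 * θ * (n : ℝ)))) →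
      ∀ t ∈ Set.Icc (0 : ℝ) s,
      (∑ j ∈ Finset.range K, (1 / 2 : ℝ) *
        (4 * Real.exp (ν * (1 + ε₀) ^ ((2 : ℝ) * (((j : ℤ) + 1 : ℤ) : ℝ)) * t) *
          ((1 / 5 : ℝ) * (1 + ε₀) ^ ((5 : ℝ) * ((j : ℤ) : ℝ) / 2) *
            ∫ u in (0 : ℝ)..t, X 0 (j : ℤ) u ^ 4)) ^ ((2 : ℝ) / 3)) ≤
      (1 - q) * (∑ i : Fin 4, (1 / 2 : ℝ) * X₀ i ^ 2)) :
    ¬ OrthantTailCeiling := by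
  obtain ⟨ε₀, hε, hε1, q, hq, hocc⟩ := h
  exact orthantTailCeiling_false_of_sideBranchCeilingEscape
    ⟨ε₀, hε, hε1, sideBranchCeilingEscapeAt_of_occupationBound hε hq hocc⟩

/-- **`ForwardTailCeiling` (stmt-26608) BY NAME modulo the fourth-moment occupation bound at some
`ε₀ ∈ (0,1]`** (twin reduction of record).  MODEL lattice only; conditional; settles nothing by itself.
[this file] -/
theorem forwardTailCeiling_false_of_occupationBound
    (h : ∃ ε₀ : ℝ, 0 < ε₀ ∧ ε₀ ≤ 1 ∧ ∃ q : ℝ, 0 < q ∧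
      ∀ θ : ℝ, 1 / 2 < θ → ∀ C : ℝ, 0 ≤ C →
      ∃ X₀ : Fin 4 → ℝ, 0 ≤ X₀ 0 ∧ X₀ 1 = 0 ∧ X₀ 2 = 0 ∧ X₀ 3 = 0 ∧
      0 < (∑ i : Fin 4, (1 / 2 : ℝ) * X₀ i ^ 2) ∧
      ∀ K : ℕ, ∃ ν₀ : ℝ, 0 < ν₀ ∧ ∀ ν : ℝ, 0 < ν → ν ≤ ν₀ → ∀ s : ℝ, 0 < s →
      ∀ X : Fin 4 → ℤ → ℝ → ℝ,
      (∀ (i : Fin 4) (k : ℤ), X i k 0 = if k = 0 then X₀ i else 0) →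
      (∀ (i : Fin 4) (k : ℤ), k < 0 → ∀ t : ℝ, X i k t = 0) →
      (∃ M : ℝ, ∀ (t : ℝ) (i : Fin 4) (k : ℤ), (1 + (1 + ε₀) ^ ((10 : ℝ) * k)) * |X i k t| ≤ M) →
      (∀ (i : Fin 4) (k : ℤ), Continuous (X i k)) →
      (∀ (i : Fin 4) (k : ℤ), ∀ t ∈ Set.Icc (0 : ℝ) s, HasDerivWithinAt (X i k)
      (quadTerm ε₀ sideBranchTable X i k t - ν * (1 + ε₀) ^ ((2 : ℝ) * k) * X i k t)
      (Set.Icc (0 : ℝ) s) t) →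
      (∀ t ∈ Set.Icc (0 : ℝ) s, ∀ (i : Fin 4) (k : ℤ), 1 ≤ k → 0 ≤ X i k t) →
      (∀ n N : ℕ, n ≤ N → ∀ u ∈ Set.Icc (0 : ℝ) s,
      ∑ k ∈ Finset.Icc n N, ∑ i : Fin 4, (1 / 2 : ℝ) * X i (k : ℤ) u ^ 2 ≤
      C * (∑ i : Fin 4, (1 / 2 : ℝ) * X₀ i ^ 2) * (1 + ε₀) ^ (-(2 * θ * (n : ℝ)))) →
      ∀ t ∈ Set.Icc (0 : ℝ) s,
      (∑ j ∈ Finset.range K, (1 / 2 : ℝ) *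
        (4 * Real.exp (ν * (1 + ε₀) ^ ((2 : ℝ) * (((j : ℤ) + 1 : ℤ) : ℝ)) * t) *
          ((1 / 5 : ℝ) * (1 + ε₀) ^ ((5 : ℝ) * ((j : ℤ) : ℝ) / 2) *
            ∫ u in (0 : ℝ)..t, X 0 (j : ℤ) u ^ 4)) ^ ((2 : ℝ) / 3)) ≤
      (1 - q) * (∑ i : Fin 4, (1 / 2 : ℝ) * X₀ i ^ 2)) :
    ¬ ForwardTailCeiling := by
  obtain ⟨ε₀, hε, hε1, q, hq, hocc⟩ := h
  exact forwardTailCeiling_false_of_sideBranchCeilingEscape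
    ⟨ε₀, hε, hε1, sideBranchCeilingEscapeAt_of_occupationBound hε hq hocc⟩

end Summit.NavierStokesRegularity.NavierStokesRegularity.Theorems.SubOnsagerCeiling

end
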